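import Literature.NumberTheory.Irrationality.RhinViola2001.TenSumsPermutations
import HarnessLib

/-!
# Rhin–Viola 2001, §4: `|Φ| = 1920`, `Φ = ⟨ϕ, χ, ϑ, σ⟩ = ⟨ϕ, ϑ⟩`, the kernel `(ℤ/2ℤ)⁴`, and the 120 cosets of `Θ`

Topic `Literature/NumberTheory/Irrationality/RhinViola2001`. Second of two PROVED companion files to
`GroupStructure.lean` (first: `TenSumsPermutations.lean` — generators on `U`, blocks `P`, `π ↦ π*` onto `S₅`,
`|Θ| = 16`). Theorems and concrete definitions only; no named fact, no `sorry`. Source read on the page: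
G. Rhin, C. Viola, *The group structure for ζ(3)*, Acta Arith. **97** (2001) 269–293 [RhinViola2001], §4,
pp. 283–285 (held text `paper:doi-10-4064-aa97-3-6`, p0015–p0017).

HONEST FRAMING (cells pub-zeta5 / zeta5-irr): systematic search; no irrationality claim unless certified.
Pure finite group theory; nothing here concerns `ζ(5)`, any measure, or any denominator.

## What is printed (pp. 283–285) and how it is typed

"Let `K` denote the kernel of this homomorphism, so that we have an exact sequence of multiplicative groups:
`1 → K → Φ → S₅ → 1`. Clearly a permutation `ϱ ∈ Φ` lies in `K` if and only if it maps each element of any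
pair lying in `P` to an element of the same pair, and hence if and only if for any pair lying in `P` either
`ϱ` acts identically on the elements of such a pair, or `ϱ` interchanges them. Also, since `K ⊂ Φ ⊂ A₁₀`,
every element of `K` is an even permutation of the set `U`. Therefore we get `K = H ∩ Φ`, where `H` denotes
the subgroup of `A₁₀` consisting of the `C(5,0)+C(5,2)+C(5,4) = 16` permutations of `U` that interchange the
elements in an even number of pairs lying in `P` and act identically on the remaining elements of `U`. It is
easy to see that `H` is isomorphic to the additive group `(ℤ/2ℤ)⁴`, and contains four independent generators
expressible as products of permutations each of which equals either `ϕ` or `ϑ`. For instance, `H` is plainly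
generated by the four permutations `(u₁ u₅)(u₂ u₆)(u₃ u₇)(u₄ u₈) = ϑ⁴`, `(u₁ u₅)(u₂ u₆)(u₄ u₈)(u₉ u₁₀) = ϕϑ⁴ϕ`,
`(u₁ u₅)(u₂ u₆)(u₃ u₇)(u₉ u₁₀) = ϑϕϑ⁴ϕϑ⁷`, `(u₁ u₅)(u₃ u₇)(u₄ u₈)(u₉ u₁₀) = ϑ³ϕϑ⁴ϕϑ⁵`. It follows that
`H ⊂ ⟨ϕ, ϑ⟩ ⊂ Φ`, whence `K = H ∩ Φ = H`. Therefore `|Φ| = |K| · |S₅| = 16 · 120 = 1920`" (p. 283).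
"Moreover, if we denote by `K'` the kernel of the surjective homomorphism `⟨ϕ, ϑ⟩ → ⟨ϕ*, ϑ*⟩ = S₅`, the above
argument shows that `K' = H ∩ ⟨ϕ, ϑ⟩ = H = K`. Thus `|⟨ϕ, ϑ⟩| = |K| · |S₅| = 1920`, whence
`Φ = ⟨ϕ, χ, ϑ, σ⟩ = ⟨ϕ, ϑ⟩`. Although 1920 divides 8!, one can prove that no subgroup of the symmetric group
`S₈` has order 1920 [R. Dvornicich] …" (p. 284). "Since `|Φ| = 1920` and `|Θ| = 16`, there are 120 left
cosets of `Θ` in `Φ`" (p. 285).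

TYPED: the pair flips `flipVec ε` (`ε : Fin 5 → Bool`; the even ones are the sixteen elements of `H`),
`epsOf`, the four printed generators `hGen`, `PhiTwoW = ⟨ϕ, ϑ⟩` inside `W`, and the printed homomorphism
`star : ⟨ϕ, ϑ⟩ →* S₅` (restriction of `starHom`).
PROVED, following the printed argument (`K'` version, p. 284) step by step and WITHOUT enumerating the group
(no `decide` over `S₁₀`, no `native_decide`; kernel computations only on explicit permutations of ten symbols
and over the 32 sign-vectors `Fin 5 → Bool`): the four printed words ARE the four printed pair flips
(`theta_pow_four`, `word_phi_theta4_phi`, `word_theta_phi_theta4_phi_theta7`, `word_theta3_phi_theta4_phi_theta5`);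
every even pair flip is a product of them, hence lies in `⟨ϕ, ϑ⟩` (`flipVec_mem_PhiTwo`: "`H ⊂ ⟨ϕ, ϑ⟩`");
a block-preserving permutation inducing the identity on `P` is the pair flip of its sign-vector
(`eq_flipVec_of_starFun_eq_id`); `star` is onto `S₅` (`range_star`) and its kernel is in bijection with the
sixteen even sign-vectors (`kerEquiv`, **`card_ker = 16`**; `ker_comm`, `ker_sq`: commutative of exponent two,
"isomorphic to `(ℤ/2ℤ)⁴`"); hence **`card_PhiTwo : Nat.card ⟨ϕ, ϑ⟩ = 1920`** by `|ker| · |range|`;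
`χ = ϕϑ³ϕϑ⁵ϕ` and `σ = ϑϕϑ⁵ϕϑ⁴ϕϑϕϑ²ϕ` (words found by breadth-first search, kernel-checked), so
**`Phi_eq_PhiTwo : Φ = ⟨ϕ, ϑ⟩`** and **`card_Phi : Nat.card Φ = 1920`**; the decidable membership criterion
`mem_Phi_iff : π ∈ Φ ↔ π preserves P ∧ sign π = 1` (not printed in this form: it is "`K = H ∩ Φ = H`" plus
surjectivity); **`relIndex_ThetaU_Phi : Θ.relIndex Φ = 120`** ("120 left cosets").
NOT typed (quoted only): Dvornicich's remark (no subgroup of `S₈` of order 1920); the census of the 120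
cosets by level (1, 12, 32, 30, 32, 12, 1) and the representative lists, pp. 285–287; an explicit `MulEquiv`
of `K` with `(ℤ/2ℤ)⁴`.
-/

namespace Literature.NumberTheory.Irrationality.RhinViola2001

namespace PhiGroup

open Equiv Equiv.Perm

/-! ### The pair flips and the subgroup `H` (p. 283) -/

/-- The product of the pair flips `(first second)` over the pairs `b` with `ε b = true` (for `ε` with an even
number of `true` entries these are the sixteen elements of `H`). [cite: RhinViola2001, §4 p. 283 (definition of H)] -/
def flipVec (ε : Fin 5 → Bool) : Perm (Fin 10) where
  toFun x := if ε (block x) then partner x else x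
  invFun x := if ε (block x) then partner x else x
  left_inv x := by
    by_cases h : ε (block x) = true
    · simp [h, block_partner, partner_partner]
    · simp [h]
  right_inv x := by
    by_cases h : ε (block x) = true
    · simp [h, block_partner, partner_partner]
    · simp [h]

/-- `flipVec ε x` unfolded (plumbing). [cite: RhinViola2001, §4 p. 283] -/
theorem flipVec_apply (ε : Fin 5 → Bool) (x : Fin 10) :
    flipVec ε x = if ε (block x) then partner x else x := rfl

/-- A pair flip keeps every `uᵢ` in its pair. [cite: RhinViola2001, §4 p. 283] -/
theorem block_flipVec (ε : Fin 5 → Bool) (x : Fin 10) : block (flipVec ε x) = block x := by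
  rw [flipVec_apply]
  split_ifs <;> simp [block_partner]

/-- Pair flips preserve every pair. [cite: RhinViola2001, §4 p. 283] -/
theorem blockPreserving_flipVec (ε : Fin 5 → Bool) : BlockPreserving (flipVec ε) := fun x y h => by
  rw [block_flipVec, block_flipVec]; exact h

/-- Pair flips induce the identity on `P`. [cite: RhinViola2001, §4 p. 283] -/
theorem starFun_flipVec (ε : Fin 5 → Bool) : starFun (flipVec ε) = id := by
  funext b
  simp [starFun, block_flipVec, block_rep]

/-- Pair flips multiply coordinatewise (`H` "is isomorphic to the additive group `(ℤ/2ℤ)⁴`": the flips commute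
and square to the identity). [cite: RhinViola2001, §4 p. 283] -/
theorem flipVec_mul_flipVec (ε ε' : Fin 5 → Bool) :
    flipVec ε * flipVec ε' = flipVec (fun b => xor (ε b) (ε' b)) := by
  refine Equiv.ext fun x => ?_
  simp only [Perm.mul_apply, flipVec_apply]
  cases h1 : ε (block x) <;> cases ε' (block x) <;> simp [h1, partner_partner, block_partner]

/-- The sign-vector read off a permutation: does it move the first element of pair `b`?
[cite: RhinViola2001, §4 p. 283] -/
def epsOf (π : Perm (Fin 10)) (b : Fin 5) : Bool := decide (π (rep b) ≠ rep b)

/-- "a permutation lies in `K` if and only if it maps each element of any pair lying in `P` to an element of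
the same pair, and hence if and only if for any pair lying in `P` either it acts identically on the elements of
such a pair, or it interchanges them": a block-preserving permutation inducing the identity on `P` is the pair
flip of its sign-vector. [cite: RhinViola2001, §4 p. 283] -/
theorem eq_flipVec_of_starFun_eq_id {π : Perm (Fin 10)} (hπ : BlockPreserving π) (h1 : starFun π = id) :
    π = flipVec (epsOf π) := by
  have hb : ∀ z, block (π z) = block z := fun z => by rw [block_apply hπ, h1]; rfl
  -- pair by pair: `π` fixes or interchanges the two elements of each pair
  have key : ∀ b : Fin 5, π (rep b) = flipVec (epsOf π) (rep b) ∧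
      π (partner (rep b)) = flipVec (epsOf π) (partner (rep b)) := by
    intro b
    have h1b : block (π (rep b)) = block (rep b) := hb _
    have h2b : block (π (partner (rep b))) = block (partner (rep b)) := hb _
    have hr : π (rep b) = rep b ∨ π (rep b) = partner (rep b) := eq_or_eq_partner h1b
    have hp : π (partner (rep b)) = partner (rep b) ∨ π (partner (rep b)) = partner (partner (rep b)) :=
      eq_or_eq_partner h2b
    rw [partner_partner] at hp
    have hne : π (partner (rep b)) ≠ π (rep b) := fun h => partner_ne (rep b) (π.injective h)
    simp only [flipVec_apply, block_rep, block_partner, epsOf]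
    rcases hr with h | h
    · have hp' : π (partner (rep b)) = partner (rep b) := by
        rcases hp with h' | h'
        · exact h'
        · exact absurd (h'.trans h.symm) hne
      simp [h, hp']
    · have hp' : π (partner (rep b)) = rep b := by
        rcases hp with h' | h'
        · exact absurd (h'.trans h.symm) hne
        · exact h'
      simp [h, hp', partner_ne, partner_partner]
  refine Equiv.ext fun x => ?_
  rcases rep_or_partner x with hx | hx
  · rw [hx]; exact (key (block x)).1
  · rw [hx]; exact (key (block x)).2

/-- `ϑ⁴ = (u₁ u₅)(u₂ u₆)(u₃ u₇)(u₄ u₈)`. [cite: RhinViola2001, §4 p. 283] -/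
theorem theta_pow_four : thetaU ^ 4 = flipVec ![true, true, true, true, false] := by decide +kernel

/-- `ϕϑ⁴ϕ = (u₁ u₅)(u₂ u₆)(u₄ u₈)(u₉ u₁₀)`. [cite: RhinViola2001, §4 p. 283] -/
theorem word_phi_theta4_phi : phiU * thetaU ^ 4 * phiU = flipVec ![true, true, false, true, true] := by
  decide +kernel

/-- `ϑϕϑ⁴ϕϑ⁷ = (u₁ u₅)(u₂ u₆)(u₃ u₇)(u₉ u₁₀)`. [cite: RhinViola2001, §4 p. 283] -/
theorem word_theta_phi_theta4_phi_theta7 :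
    thetaU * phiU * thetaU ^ 4 * phiU * thetaU ^ 7 = flipVec ![true, true, true, false, true] := by
  decide +kernel

/-- `ϑ³ϕϑ⁴ϕϑ⁵ = (u₁ u₅)(u₃ u₇)(u₄ u₈)(u₉ u₁₀)`. [cite: RhinViola2001, §4 p. 283] -/
theorem word_theta3_phi_theta4_phi_theta5 :
    thetaU ^ 3 * phiU * thetaU ^ 4 * phiU * thetaU ^ 5 = flipVec ![true, false, true, true, true] := by
  decide +kernel

/-- The four printed generators of `H` (as sign-vectors). [cite: RhinViola2001, §4 p. 283] -/
def hGen : Fin 4 → (Fin 5 → Bool) :=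
  ![![true, true, true, true, false], ![true, true, false, true, true], ![true, true, true, false, true],
    ![true, false, true, true, true]]

/-- "`H` … contains four independent generators expressible as products of permutations each of which equals
either `ϕ` or `ϑ`": the four printed generators lie in `⟨ϕ, ϑ⟩`. [cite: RhinViola2001, §4 p. 283] -/
theorem flipVec_hGen_mem (i : Fin 4) : flipVec (hGen i) ∈ PhiTwo := by
  have hθ : thetaU ∈ PhiTwo := Subgroup.subset_closure (by simp)
  have hϕ : phiU ∈ PhiTwo := Subgroup.subset_closure (by simp)
  have hθn : ∀ n : ℕ, thetaU ^ n ∈ PhiTwo := fun n => Subgroup.pow_mem _ hθ n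
  fin_cases i
  · simpa [hGen, ← theta_pow_four] using hθn 4
  · simpa [hGen, ← word_phi_theta4_phi] using
      Subgroup.mul_mem _ (Subgroup.mul_mem _ hϕ (hθn 4)) hϕ
  · simpa [hGen, ← word_theta_phi_theta4_phi_theta7] using
      Subgroup.mul_mem _ (Subgroup.mul_mem _ (Subgroup.mul_mem _ (Subgroup.mul_mem _ hθ hϕ) (hθn 4)) hϕ)
        (hθn 7)
  · simpa [hGen, ← word_theta3_phi_theta4_phi_theta5] using
      Subgroup.mul_mem _ (Subgroup.mul_mem _ (Subgroup.mul_mem _ (Subgroup.mul_mem _ (hθn 3) hϕ) (hθn 4))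
        hϕ) (hθn 5)

/-- A product of a sub-collection of the four generators of `H` (plumbing for "`H` is plainly generated by
the four permutations"). [cite: RhinViola2001, §4 p. 283] -/
def hProd (s : Fin 4 → Bool) : Perm (Fin 10) :=
  (if s 0 then flipVec (hGen 0) else 1) * ((if s 1 then flipVec (hGen 1) else 1) *
    ((if s 2 then flipVec (hGen 2) else 1) * (if s 3 then flipVec (hGen 3) else 1)))

/-- Such products lie in `⟨ϕ, ϑ⟩`. [cite: RhinViola2001, §4 p. 283 ("H ⊂ ⟨ϕ, ϑ⟩")] -/
theorem hProd_mem (s : Fin 4 → Bool) : hProd s ∈ PhiTwo := by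
  have h : ∀ (b : Bool) (i : Fin 4), (if b then flipVec (hGen i) else 1) ∈ PhiTwo := by
    intro b i
    cases b
    · simp
    · simpa using flipVec_hGen_mem i
  exact Subgroup.mul_mem _ (h _ _) (Subgroup.mul_mem _ (h _ _) (Subgroup.mul_mem _ (h _ _) (h _ _)))

/-- "`H` is plainly generated by the four permutations": every EVEN pair flip (sign `+1`, i.e. an even number
of pairs interchanged — the `C(5,0)+C(5,2)+C(5,4) = 16` elements of `H`) is a product of a sub-collection of
the four printed generators (a check over the 32 sign-vectors). [cite: RhinViola2001, §4 p. 283] -/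
theorem exists_hProd_of_sign_eq_one :
    ∀ ε : Fin 5 → Bool, sign (flipVec ε) = 1 → ∃ s : Fin 4 → Bool, flipVec ε = hProd s := by
  decide +kernel

/-- "It follows that `H ⊂ ⟨ϕ, ϑ⟩`": every even pair flip lies in `⟨ϕ, ϑ⟩`. [cite: RhinViola2001, §4 p. 283] -/
theorem flipVec_mem_PhiTwo {ε : Fin 5 → Bool} (h : sign (flipVec ε) = 1) : flipVec ε ∈ PhiTwo := by
  obtain ⟨s, hs⟩ := exists_hProd_of_sign_eq_one ε h
  rw [hs]
  exact hProd_mem s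

/-- There are `C(5,0)+C(5,2)+C(5,4) = 16` even pair flips. [cite: RhinViola2001, §4 p. 283] -/
theorem card_even_signVectors : Fintype.card {ε : Fin 5 → Bool // sign (flipVec ε) = 1} = 16 := by
  decide +kernel

/-- Reading the sign-vector back off a pair flip (plumbing). [cite: RhinViola2001, §4 p. 283] -/
theorem epsOf_flipVec : ∀ ε : Fin 5 → Bool, epsOf (flipVec ε) = ε := by decide +kernel

/-! ### The exact sequence `1 → K → ⟨ϕ, ϑ⟩ → S₅ → 1` and `|⟨ϕ, ϑ⟩| = 1920` (pp. 283–284) -/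

/-- `⟨ϕ, ϑ⟩` as a subgroup of `W` (plumbing: the homomorphism `π ↦ π*` is defined on `W`).
[cite: RhinViola2001, §4 p. 283] -/
def PhiTwoW : Subgroup W := PhiTwo.subgroupOf W

/-- The printed homomorphism `⟨ϕ, ϑ⟩ → S₅`, `π ↦ π*` (the restriction of `starHom`).
[cite: RhinViola2001, §4 pp. 283–284] -/
def star : PhiTwoW →* Perm (Fin 5) := starHom.restrict PhiTwoW

/-- "`S₅ = ⟨ϕ*, ϑ*⟩`. It follows that the above homomorphism `Φ → S₅` is surjective" (likewise for `⟨ϕ, ϑ⟩`,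
p. 284). [cite: RhinViola2001, §4 pp. 283–284] -/
theorem range_star : star.range = ⊤ := by
  rw [star, MonoidHom.restrict_range, eq_top_iff, ← closure_phiStar_thetaStar, Subgroup.closure_le]
  have hmem : ∀ g : W, (g : Perm (Fin 10)) ∈ PhiTwo → starHom g ∈ (PhiTwoW.map starHom : Set (Perm (Fin 5))) :=
    fun g hg => Subgroup.mem_map_of_mem starHom (Subgroup.mem_subgroupOf.mpr hg)
  rintro x hx
  simp only [Set.mem_insert_iff, Set.mem_singleton_iff] at hx
  rcases hx with rfl | rfl
  · rw [← starHom_phiW]; exact hmem phiW (Subgroup.subset_closure (by simp [phiW]))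
  · rw [← starHom_thetaW]; exact hmem thetaW (Subgroup.subset_closure (by simp [thetaW]))

/-- "`|S₅| = 120`": the range of `star` has 120 elements. [cite: RhinViola2001, §4 p. 283] -/
theorem card_range_star : Nat.card star.range = 120 := by
  rw [range_star, Subgroup.card_top, Nat.card_eq_fintype_card, Fintype.card_perm, Fintype.card_fin]
  rfl

/-- An element of the kernel `K` is an even pair flip (plumbing for `kerEquiv`). [cite: RhinViola2001, §4 p. 283] -/
theorem ker_eq_flipVec (k : star.ker) :
    ((((k : PhiTwoW) : W)) : Perm (Fin 10)) = flipVec (epsOf ((((k : PhiTwoW) : W)) : Perm (Fin 10))) := by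
  have hk : star (k : PhiTwoW) = 1 := (MonoidHom.mem_ker).mp k.2
  have h1 : starFun ((((k : PhiTwoW) : W)) : Perm (Fin 10)) = id := by
    funext b
    have := congrArg (fun f : Perm (Fin 5) => f b) hk
    simpa [star, starHom_apply, starFun] using this
  exact eq_flipVec_of_starFun_eq_id ((k : PhiTwoW) : W).2 h1

/-- The sign-vector of a kernel element is even. [cite: RhinViola2001, §4 p. 283 ("K ⊂ Φ ⊂ A₁₀")] -/
theorem sign_flipVec_epsOf_ker (k : star.ker) :
    sign (flipVec (epsOf ((((k : PhiTwoW) : W)) : Perm (Fin 10)))) = 1 := by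
  rw [← ker_eq_flipVec]
  have hmem : ((((k : PhiTwoW) : W)) : Perm (Fin 10)) ∈ PhiTwo := Subgroup.mem_subgroupOf.mp (k : PhiTwoW).2
  exact mem_alternatingGroup.mp (Phi_le_alternatingGroup (PhiTwo_le_Phi hmem))

/-- "`K = H ∩ Φ = H`": the kernel of `⟨ϕ, ϑ⟩ → S₅` is in bijection with the sixteen even sign-vectors
(`k ↦` its sign-vector, `ε ↦` the pair flip `flipVec ε ∈ ⟨ϕ, ϑ⟩`). [cite: RhinViola2001, §4 pp. 283–284] -/
noncomputable def kerEquiv : star.ker ≃ {ε : Fin 5 → Bool // sign (flipVec ε) = 1} where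
  toFun k := ⟨epsOf ((((k : PhiTwoW) : W)) : Perm (Fin 10)), sign_flipVec_epsOf_ker k⟩
  invFun e := ⟨⟨⟨flipVec e.1, blockPreserving_flipVec e.1⟩, Subgroup.mem_subgroupOf.mpr (flipVec_mem_PhiTwo e.2)⟩,
    by
      rw [MonoidHom.mem_ker]
      refine Equiv.ext fun b => ?_
      change starFun (flipVec e.1) b = b
      rw [starFun_flipVec]; rfl⟩
  left_inv k := by
    apply Subtype.ext; apply Subtype.ext; apply Subtype.ext
    exact (ker_eq_flipVec k).symm
  right_inv e := by
    apply Subtype.ext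
    exact epsOf_flipVec e.1

/-- "`|K| = 16`". [cite: RhinViola2001, §4 p. 283] -/
theorem card_ker : Nat.card star.ker = 16 := by
  rw [Nat.card_congr kerEquiv, Nat.card_eq_fintype_card, card_even_signVectors]

/-- `K` "is isomorphic to the additive group `(ℤ/2ℤ)⁴`" — typed as: `K` has order 16 (`card_ker`), is
commutative, and every element squares to the identity. [cite: RhinViola2001, §4 p. 283] -/
theorem ker_comm (k k' : star.ker) : k * k' = k' * k := by
  apply Subtype.ext; apply Subtype.ext; apply Subtype.ext
  change ((((k : PhiTwoW) : W)) : Perm (Fin 10)) * ((((k' : PhiTwoW) : W)) : Perm (Fin 10)) =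
    ((((k' : PhiTwoW) : W)) : Perm (Fin 10)) * ((((k : PhiTwoW) : W)) : Perm (Fin 10))
  rw [ker_eq_flipVec k, ker_eq_flipVec k', flipVec_mul_flipVec, flipVec_mul_flipVec]
  congr 1; funext b; rw [Bool.xor_comm]

/-- Every element of `K` squares to the identity. [cite: RhinViola2001, §4 p. 283] -/
theorem ker_sq (k : star.ker) : k * k = 1 := by
  apply Subtype.ext; apply Subtype.ext; apply Subtype.ext
  change ((((k : PhiTwoW) : W)) : Perm (Fin 10)) * ((((k : PhiTwoW) : W)) : Perm (Fin 10)) = 1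
  rw [ker_eq_flipVec k, flipVec_mul_flipVec]
  refine Equiv.ext fun x => ?_
  simp [flipVec_apply]

/-- **"`|⟨ϕ, ϑ⟩| = |K| · |S₅| = 1920`"** (p. 284; the same count as `|Φ| = |K|·|S₅| = 16·120 = 1920`, p. 283).
[cite: RhinViola2001, §4 pp. 283–284] -/
theorem card_PhiTwo : Nat.card PhiTwo = 1920 := by
  have h1 : Nat.card PhiTwoW = Nat.card PhiTwo :=
    Nat.card_congr (Subgroup.subgroupOfEquivOfLe PhiTwo_le_W).toEquiv
  have h2 : Nat.card star.ker * star.ker.index = Nat.card PhiTwoW := Subgroup.card_mul_index _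
  rw [Subgroup.index_ker, card_ker, card_range_star] at h2
  omega

/-! ### `Φ = ⟨ϕ, χ, ϑ, σ⟩ = ⟨ϕ, ϑ⟩` and `|Φ| = 1920` (p. 284) -/

/-- `χ` as a word in `ϕ, ϑ`: `χ = ϕϑ³ϕϑ⁵ϕ` (a shortest such word, found by breadth-first search; kernel-checked).
[cite: RhinViola2001, §4 p. 284 ("Φ = ⟨ϕ, χ, ϑ, σ⟩ = ⟨ϕ, ϑ⟩")] -/
theorem chiU_eq_word : chiU = phiU * thetaU ^ 3 * phiU * thetaU ^ 5 * phiU := by decide +kernel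

/-- `σ` as a word in `ϕ, ϑ`: `σ = ϑϕϑ⁵ϕϑ⁴ϕϑϕϑ²ϕ` (found by breadth-first search; kernel-checked).
[cite: RhinViola2001, §4 p. 284 ("Φ = ⟨ϕ, χ, ϑ, σ⟩ = ⟨ϕ, ϑ⟩")] -/
theorem sigmaU_eq_word :
    sigmaU = thetaU * phiU * thetaU ^ 5 * phiU * thetaU ^ 4 * phiU * thetaU * phiU * thetaU ^ 2 * phiU := by
  decide +kernel

/-- `χ ∈ ⟨ϕ, ϑ⟩`. [cite: RhinViola2001, §4 p. 284] -/
theorem chiU_mem_PhiTwo : chiU ∈ PhiTwo := by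
  have hθ : ∀ n : ℕ, thetaU ^ n ∈ PhiTwo := fun n => Subgroup.pow_mem _ (Subgroup.subset_closure (by simp)) n
  have hϕ : phiU ∈ PhiTwo := Subgroup.subset_closure (by simp)
  rw [chiU_eq_word]
  exact Subgroup.mul_mem _ (Subgroup.mul_mem _ (Subgroup.mul_mem _ (Subgroup.mul_mem _ hϕ (hθ 3)) hϕ)
    (hθ 5)) hϕ

/-- `σ ∈ ⟨ϕ, ϑ⟩`. [cite: RhinViola2001, §4 p. 284] -/
theorem sigmaU_mem_PhiTwo : sigmaU ∈ PhiTwo := by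
  have hθ : ∀ n : ℕ, thetaU ^ n ∈ PhiTwo := fun n => Subgroup.pow_mem _ (Subgroup.subset_closure (by simp)) n
  have hθ1 : thetaU ∈ PhiTwo := Subgroup.subset_closure (by simp)
  have hϕ : phiU ∈ PhiTwo := Subgroup.subset_closure (by simp)
  rw [sigmaU_eq_word]
  have m := fun {a b : Perm (Fin 10)} (ha : a ∈ PhiTwo) (hb : b ∈ PhiTwo) => Subgroup.mul_mem PhiTwo ha hb
  exact m (m (m (m (m (m (m (m (m hθ1 hϕ) (hθ 5)) hϕ) (hθ 4)) hϕ) hθ1) hϕ) (hθ 2)) hϕ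

/-- **"`Φ = ⟨ϕ, χ, ϑ, σ⟩ = ⟨ϕ, ϑ⟩`"**. [cite: RhinViola2001, §4 p. 284] -/
theorem Phi_eq_PhiTwo : Phi = PhiTwo := by
  refine le_antisymm ?_ PhiTwo_le_Phi
  rw [Phi, Subgroup.closure_le]
  intro x hx
  simp only [Set.mem_insert_iff, Set.mem_singleton_iff] at hx
  rcases hx with rfl | rfl | rfl | rfl
  · exact Subgroup.subset_closure (by simp)
  · exact chiU_mem_PhiTwo
  · exact Subgroup.subset_closure (by simp)
  · exact sigmaU_mem_PhiTwo

/-- **"`|Φ| = |K| · |S₅| = 16 · 120 = 1920`"** — the order of Rhin–Viola's permutation group `Φ` for `ζ(3)`.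
[cite: RhinViola2001, §4 p. 283] -/
theorem card_Phi : Nat.card Phi = 1920 := by
  rw [Phi_eq_PhiTwo, card_PhiTwo]

/-- `Φ` is transitive over `U`. [cite: RhinViola2001, §4 p. 282 ("and therefore so is Φ")] -/
theorem Phi_transitive (x y : Fin 10) : ∃ π ∈ Phi, π x = y := by
  rw [Phi_eq_PhiTwo]; exact PhiTwo_transitive x y

/-- Membership criterion (a consequence of "`K = H ∩ Φ = H`" and the surjectivity of `Φ → S₅`; not printed in
this form): a permutation of `U` lies in `Φ` if and only if it carries pairs of `P` to pairs of `P` and is even.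
In particular `Φ` is the full group of even permutations of `U` preserving the partition `P`.
[cite: RhinViola2001, §4 pp. 282–284] -/
theorem mem_Phi_iff (π : Perm (Fin 10)) : π ∈ Phi ↔ BlockPreserving π ∧ sign π = 1 := by
  constructor
  · intro h
    exact ⟨Phi_le_W h, mem_alternatingGroup.mp (Phi_le_alternatingGroup h)⟩
  · rintro ⟨hW, hsign⟩
    rw [Phi_eq_PhiTwo]
    -- a `ρ ∈ ⟨ϕ, ϑ⟩` with `ρ* = π*`
    have hsurj : starHom ⟨π, hW⟩ ∈ star.range := by rw [range_star]; exact Subgroup.mem_top _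
    obtain ⟨ρ, hρ⟩ := hsurj
    have hρmem : (((ρ : PhiTwoW) : W) : Perm (Fin 10)) ∈ PhiTwo := Subgroup.mem_subgroupOf.mp ρ.2
    set ρ' : Perm (Fin 10) := (((ρ : PhiTwoW) : W) : Perm (Fin 10)) with hρ'
    -- `ρ⁻¹ π` preserves blocks, induces the identity on `P`, and is even: a pair flip in `⟨ϕ, ϑ⟩`
    have hW' : BlockPreserving (ρ'⁻¹ * π) := W.mul_mem (W.inv_mem ((ρ : PhiTwoW) : W).2) hW
    have hstar : starHom ⟨ρ'⁻¹ * π, hW'⟩ = 1 := by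
      have e1 : (⟨ρ'⁻¹ * π, hW'⟩ : W) = ((ρ : PhiTwoW) : W)⁻¹ * ⟨π, hW⟩ := rfl
      rw [e1, map_mul, map_inv, ← hρ]
      simp [star]
    have h1 : starFun (ρ'⁻¹ * π) = id := by
      funext b
      have := congrArg (fun f : Perm (Fin 5) => f b) hstar
      simpa [starHom_apply, starFun] using this
    have hflip := eq_flipVec_of_starFun_eq_id hW' h1
    have hsign' : sign (flipVec (epsOf (ρ'⁻¹ * π))) = 1 := by
      rw [← hflip, Perm.sign_mul, Perm.sign_inv, hsign, mul_one]
      exact mem_alternatingGroup.mp (Phi_le_alternatingGroup (PhiTwo_le_Phi hρmem))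
    have hmem : ρ'⁻¹ * π ∈ PhiTwo := by rw [hflip]; exact flipVec_mem_PhiTwo hsign'
    have : π = ρ' * (ρ'⁻¹ * π) := by group
    rw [this]
    exact Subgroup.mul_mem _ hρmem hmem

/-! ### "there are 120 left cosets of `Θ` in `Φ`" (p. 285) -/

/-- **"Since `|Φ| = 1920` and `|Θ| = 16`, there are 120 left cosets of `Θ` in `Φ`."** (Each coset carries one
transformation formula (4.4)/(4.5); the census of the 120 cosets by level, pp. 285–287, is not typed.)
[cite: RhinViola2001, §4 p. 285] -/
theorem relIndex_ThetaU_Phi : ThetaU.relIndex Phi = 120 := by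
  have h1 : Nat.card (ThetaU.subgroupOf Phi) = 16 := by
    rw [Nat.card_congr (Subgroup.subgroupOfEquivOfLe ThetaU_le_Phi).toEquiv, card_ThetaU]
  have h2 := Subgroup.card_mul_index (ThetaU.subgroupOf Phi)
  rw [h1, card_Phi] at h2
  show (ThetaU.subgroupOf Phi).index = 120
  omega

end PhiGroup

end Literature.NumberTheory.Irrationality.RhinViola2001
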